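import Literature.NumberTheory.DiophantineGeometry.AbcWave0GranvilleStarkTheorem1Proofs
import Literature.NumberTheory.DiophantineGeometry.AbcWave0GranvilleStarkTheorem1AnyConstantProofs
import Literature.NumberTheory.EllipticCurves.SingularModuliIntegral
import HarnessLib

/-!
# Granville–Stark, Theorem 1: uniform `abc` ⟹ `h(−d) ≥ (π/3 + o(1)) √d / log d`, from Lemma 1 ALONE

Topic `NumberTheory/DiophantineGeometry` (family `abc`, record `abc.S22`).  Proofs-only file
(theorems only: no definitions, no named facts) on the named fact
`Literature.NumberTheory.DiophantineGeometry.granville_stark : UniformABCConjecture → ImaginaryQuadraticClassNumberBound`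
(A. Granville, H. M. Stark, *ABC implies no "Siegel zeros" for `L`-functions of characters with
negative discriminant*, Invent. Math. 139 (2000), Theorem 1).

The tree has the whole deduction of Theorem 1 from the complex-multiplication input of its printed
proof in two forms: `granville_stark_of_cmInput` (`…Theorem1Proofs.lean`, constant `6`, all `d`) and
`granville_stark_of_lemma1` (`…Theorem1AnyConstantProofs.lean`, any constant `B`, `d ≥ d₁`).  In both
the hypothesis packages TWO facts quoted on p. 512 of the paper: (i) `j(τ_D)` — hence
`γ₂(τ_D) = ∛j`, `γ₃(τ_D) = √(j − 1728)` — is an algebraic INTEGER ("The value of `j(τ)` … is an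
algebraic integer", (5)), and (ii) **Lemma 1** (`Δ_{k(γ₂,γ₃)} ≤ 6√d`).  Input (i) is now a THEOREM of
the tree (`Literature.NumberTheory.EllipticCurves.isIntegral_int_formJ`, Cox Thm. 11.1 (i),
`SingularModuliIntegral.lean`), so this file cuts both hypotheses down to Lemma 1 alone:

* `isIntegral_int_formJ_principalForm` — `j(τ_D)`, `D = d_K`, is an algebraic integer for every
  imaginary quadratic field `K`;
* `isIntegral_int_of_map_pow_eq` — `ι(u)^n = c` with `c` an algebraic integer (`n ≥ 1`, `ι : F → ℂ` a
  field embedding) makes `u` an algebraic integer (so `γ₂(τ)`, `γ₃(τ)` are algebraic integers, (5));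
* `granville_stark_of_discrBound` — **`granville_stark` from Lemma 1 with an arbitrary constant and
  threshold**: `∃ B d₁, ∀ K` imaginary quadratic with `|d_K| ≥ d₁`, `∃` a number field `F`,
  `σ₀ : F → ℂ`, `u, v ∈ F` with `σ₀(u³) = j(τ_D)`, `v² = u³ − 1728`, `|D_F| ≤ (B√|d_K|)^{[F:ℚ]}`
  (no integrality assumed) — via `granville_stark_of_lemma1`;
* `granville_stark_of_lemma1_six` — the same with the printed data of Lemma 1 (`B = 6`, all `d`:
  "If `K = k(γ₂(τ), γ₃(τ))`, where `τ` is as above, then `Δ_K ≤ 6√d`", `F = k(γ₂(τ_D), γ₃(τ_D))`,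
  `u = γ₂(τ_D)`, `v = γ₃(τ_D)`; Táfula, Lemma 5.4) — via `granville_stark_of_cmInput`.

What remains for `granville_stark_holds` is exactly Lemma 1 (in either form), whose printed proof is
class field theory (`k(j(τ_D))` is the Hilbert class field of `k`; `γ₂, γ₃` generate a subfield of the
ray class field of conductor `6`; conductor–discriminant formula) — not in Mathlib or the tree, and
not restated here as a named fact (D-0026).

## References

* A. Granville, H. M. Stark, *ABC implies no "Siegel zeros" for `L`-functions of characters with
  negative discriminant*, Invent. Math. 139 (2000) 509–523: §2, p. 512 (integrality of `j(τ)`,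
  (5), Lemma 1 and the remark after it) and the proof of Theorem 1, p. 513 (held copy
  `paper:galaxy-pdf-4469120640`). [GranvilleStark2000]
* C. Táfula, *On Landau–Siegel zeros and heights of singular moduli*, Acta Arith. 201 (2021) 1–28
  (arXiv:1911.07215), §2.2 and Lemma 5.4. [Tafula2021]
* D. A. Cox, *Primes of the form x² + ny²*, 2nd ed., Wiley 2013, Thm. 11.1 (i). [Cox2013]
-/

noncomputable section

open Complex NumberField Polynomial

open Literature.NumberTheory.EllipticCurves Literature.NumberTheory.QuadraticFields.BinaryQuadraticForm
  Literature.NumberTheory.QuadraticFields.Quadratic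

namespace Literature.NumberTheory.DiophantineGeometry

/-- **`j(τ_D)` is an algebraic integer** for the principal class of an imaginary quadratic field `K`,
`D = d_K` (Granville–Stark §2, p. 512; Cox Thm. 11.1 (i) — the tree's `isIntegral_int_formJ` at the
principal form of discriminant `D ≡ 0, 1 (mod 4)`, `D < 0`).
[cite: GranvilleStark2000, §2 p. 512] [cite: Cox2013, §11.A Thm. 11.1(i)] -/
theorem isIntegral_int_formJ_principalForm (K : Type*) [Field K] [NumberField K]
    (hK : IsImaginaryQuadratic K) : IsIntegral ℤ (formJ (principalForm (NumberField.discr K))) := by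
  obtain ⟨bK, hbK⟩ := exists_basis_zero_eq_one (K := K) hK.1
  have hDK := discr_eq_sq_add_four_mul bK hbK
  have hDneg : NumberField.discr K < 0 := hK.discr_neg
  have h4 : NumberField.discr K % 4 = 0 ∨ NumberField.discr K % 4 = 1 := by
    have e : NumberField.discr K = discr (1, bK.repr (bK 1 * bK 1) 1, -(bK.repr (bK 1 * bK 1) 0)) := by
      rw [discr_apply, hDK]; ring
    rw [e]; exact discr_emod_four _
  refine isIntegral_int_formJ (by rw [principalForm_fst]; exact one_pos) (isPrimitive_principalForm _) ?_
  rw [discr_principalForm h4]; exact hDneg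

/-- **Roots of `X^n − c` over an algebraic integer `c` are algebraic integers**, transported along a
field embedding `ι : F → ℂ`: if `ι(u)^n = c`, `n ≥ 1`, `c` integral over `ℤ`, then `u` is integral over
`ℤ` (Granville–Stark (5): `j(τ) = γ₂(τ)³ = γ₃(τ)² + 1728`, so "`γ₂(τ)` and `γ₃(τ)` are also algebraic
integers"). [cite: GranvilleStark2000, §2 eq. (5)] -/
theorem isIntegral_int_of_map_pow_eq {F : Type*} [Field F] (ι : F →+* ℂ) {u : F} {n : ℕ} (hn : n ≠ 0)
    {c : ℂ} (hc : IsIntegral ℤ c) (hu : ι u ^ n = c) : IsIntegral ℤ u := by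
  set A : Subalgebra ℤ ℂ := Algebra.adjoin ℤ {c} with hA
  haveI : Algebra.IsIntegral ℤ A := Algebra.IsIntegral.adjoin (by simpa using hc)
  let c' : A := ⟨c, Algebra.self_mem_adjoin_singleton ℤ c⟩
  have h1 : IsIntegral A (ι u) := by
    refine ⟨Polynomial.X ^ n - Polynomial.C c', Polynomial.monic_X_pow_sub_C c' hn, ?_⟩
    rw [Polynomial.eval₂_sub, Polynomial.eval₂_X_pow, Polynomial.eval₂_C, hu]
    exact sub_self c
  have h2 : IsIntegral ℤ (ι u) := isIntegral_trans (ι u) h1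
  exact (isIntegral_algHom_iff ι.toIntAlgHom ι.injective).mp h2

/-- `1728` is an algebraic integer. [folklore] -/
lemma isIntegral_int_ofNat_1728 : IsIntegral ℤ (1728 : ℂ) := by
  simpa using isIntegral_algebraMap (R := ℤ) (A := ℂ) (x := 1728)

/-- **Granville–Stark, Theorem 1, from Lemma 1 alone — arbitrary constant.**  Hypothesis: constants
`B, d₁` such that for every imaginary quadratic `K` (`[K:ℚ] = 2`, no real place) with `|d_K| ≥ d₁`
there are a number field `F`, an embedding `σ₀ : F → ℂ` and `u, v ∈ F` (NOT assumed integral) with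
`σ₀(u³) = j(τ_D)`, `v² = u³ − 1728`, `|D_F| ≤ (B√|d_K|)^{[F:ℚ]}` — Lemma 1 of the paper gives this
with `F = k(γ₂(τ_D), γ₃(τ_D))`, `B = 6`, and "a more careful analysis would allow us to reduce the
factor of 6" (remark after Lemma 1).  Conclusion: `granville_stark`.  Proof: `u, v` are algebraic
integers (`isIntegral_int_formJ_principalForm`, `isIntegral_int_of_map_pow_eq`), so the hypothesis
of `granville_stark_of_lemma1` holds. [cite: GranvilleStark2000, §2 Lemma 1, remark after it, and proof of Theorem 1] -/
theorem granville_stark_of_discrBound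
    (H : ∃ B d₁ : ℝ, ∀ (K : Type) [Field K] [NumberField K],
      Module.finrank ℚ K = 2 → NumberField.InfinitePlace.nrRealPlaces K = 0 →
      d₁ ≤ |(NumberField.discr K : ℝ)| →
        ∃ (F : Type) (_ : Field F) (_ : NumberField F) (σ₀ : F →+* ℂ) (u v : F),
          σ₀ (u ^ 3) = formJ (principalForm (NumberField.discr K)) ∧
          v ^ 2 = u ^ 3 - 1728 ∧
          |(NumberField.discr F : ℝ)| ≤ (B * √|(NumberField.discr K : ℝ)|) ^ Module.finrank ℚ F) :
    granville_stark := by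
  obtain ⟨B, d₁, H⟩ := H
  refine granville_stark_of_lemma1 ⟨B, d₁, fun K _ _ h2 h0 hd ↦ ?_⟩
  obtain ⟨F, instF, instNF, σ₀, u, v, hu, hv, hdiscF⟩ := H K h2 h0 hd
  have hK : IsImaginaryQuadratic K := ⟨h2, NumberField.nrRealPlaces_eq_zero_iff.mp h0⟩
  have hj := isIntegral_int_formJ_principalForm K hK
  have hu' : IsIntegral ℤ u := isIntegral_int_of_map_pow_eq σ₀ three_ne_zero hj (by rw [← map_pow, hu])
  have hv' : IsIntegral ℤ v := by
    refine isIntegral_int_of_map_pow_eq σ₀ two_ne_zero (hj.sub isIntegral_int_ofNat_1728) ?_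
    rw [← map_pow, hv, map_sub, hu, map_ofNat]
  refine ⟨F, instF, instNF, σ₀, ⟨u, hu'⟩, ⟨v, hv'⟩, ?_, ?_, hdiscF⟩
  · exact hu
  · exact hv

/-- **Granville–Stark, Theorem 1, from Lemma 1 alone — the printed constant `6`.**  Hypothesis `H1` =
Lemma 1 of the paper in existential form: for every imaginary quadratic field `K`, `D = d_K`, a number
field `F` with an embedding `ι : F → ℂ` and `u, v ∈ F` (not assumed integral) with `ι(u)³ = j(τ_D)`,
`ι(v)² = j(τ_D) − 1728`, `|D_F| ≤ (6√|D|)^{[F:ℚ]}` ("If `K = k(γ₂(τ), γ₃(τ))`, where `τ` is as above,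
then `Δ_K ≤ 6√d`", with `F` that field, `u = γ₂(τ)`, `v = γ₃(τ)`; Táfula, Lemma 5.4).  Conclusion:
`granville_stark`.  Proof: `u, v` are algebraic integers, so `H1` yields the CM input of
`granville_stark_of_cmInput`. [cite: GranvilleStark2000, §2 Lemma 1 and proof of Theorem 1] [cite: Tafula2021, Lemma 5.4] -/
theorem granville_stark_of_lemma1_six
    (H1 : ∀ (K : Type) [Field K] [NumberField K], IsImaginaryQuadratic K →
      ∃ (F : Type) (_ : Field F) (_ : NumberField F) (ι : F →+* ℂ) (u v : F),
        ι u ^ 3 = formJ (principalForm (NumberField.discr K)) ∧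
        ι v ^ 2 = formJ (principalForm (NumberField.discr K)) - 1728 ∧
        |(NumberField.discr F : ℝ)| ≤ (6 * √|(NumberField.discr K : ℝ)|) ^ Module.finrank ℚ F) :
    granville_stark := by
  refine granville_stark_of_cmInput fun K _ _ hK ↦ ?_
  obtain ⟨F, instF, instNF, ι, u, v, hu, hv, hdiscF⟩ := H1 K hK
  have hj := isIntegral_int_formJ_principalForm K hK
  have hu' : IsIntegral ℤ u := isIntegral_int_of_map_pow_eq ι three_ne_zero hj hu
  have hv' : IsIntegral ℤ v :=
    isIntegral_int_of_map_pow_eq ι two_ne_zero (hj.sub isIntegral_int_ofNat_1728) hv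
  refine ⟨F, instF, instNF, ι, ⟨u, hu'⟩, ⟨v, hv'⟩, ?_, ?_, hdiscF⟩
  · change ι (u ^ 3) = _
    rw [map_pow, hu]
  · change ι (v ^ 2) = _
    rw [map_pow, hv]

end Literature.NumberTheory.DiophantineGeometry

end
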